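import Mathlib
import Summits.ValiantsHypothesis.ValiantsHypothesis.Theses.RigidMinimalReps
import Summits.ValiantsHypothesis.ValiantsHypothesis.Theorems.RigidMinimalRepsTorusBound
import Summits.ValiantsHypothesis.ValiantsHypothesis.Theorems.RigidMinimalRepsAssembly
import Literature.Computability.AlgebraicComplexity.GrenetEquivariant
import Literature.Computability.AlgebraicComplexity.PermanentVsDeterminantProofs
import Literature.Computability.AlgebraicComplexity.AlperBogartVelascoProofs

/-!
# Strategy census for crux `RigidMinimalReps.MinimalRepTorusSymmetric` (stmt-ValiantsHypothesis-5112):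
# calibration theorems (crux-strategist, 2026-08-17)

Kernel-checked facts used by `STRATEGY-CENSUS.md`:

* `crux_iff_grenetLowerEventually` / `crux_iff_grenetOptimalEventually` — **modulo theorems already in
  the tree, the crux `X = MinimalRepTorusSymmetric` is LITERALLY the statement "`dc(per_n) = 2ⁿ - 1` for
  all large `n`" (eventual optimality of Grenet's representation).**  (→) is `X` + the PROVED sibling crux
  `TorusBound` (`torusBound_proof`); (←) is Grenet's two-sided-torus-equivariant representation of size
  `2ⁿ - 1` (`Grenet.hasEquivariantDetRepr_perPoly_twoSidedTorus`, tree) + Grenet's upper bound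
  (`determinantalComplexity_perPoly_le_holds`, tree).  Consequently every line / split / strengthening
  of `X` must prove the exact exponential lower bound `2ⁿ - 1 ≤ dc(per_n)` — the symmetric-optimum
  phrasing carries no residual content once `TorusBound` is a theorem.
* `not_crux_of_not_summit` — `¬VH → ¬X`, i.e. `X → ValiantsHypothesis` by tree theorems alone (the route's `closes` with
  `TorusBound` discharged): the crux is at least summit-strength.
* `Doubling`, `grenetLower_of_doubling` — the induction-shaped strengthening `S⁺_ind`
  (`dc(per_n) ≥ 2·dc(per_{n-1}) + 1`, `n ≥ 4`) gives Grenet's bound for every `n ≥ 3` from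
  `dc(per_3) = 7` (Alper–Bogart–Velasco, tree); recorded to make precise that `S⁺_ind` is
  "Grenet-optimal for all n ≥ 3", strictly stronger than `X`.
* `ScalingSymmetricOptimum`, `MultigradeUpgrade`, `crux_of_split` — the best typed split found
  (`X ⟸ X_sc ∧ (X_sc → X)`, `X_sc` = some optimal representation admits exact lifts of the SCALING
  subgroup `x ↦ c·x`, i.e. is a homogeneous ABP up to constant gauge); glue is modus ponens.
-/

namespace Summit.ValiantsHypothesis.ValiantsHypothesis.Cruxes.MinimalRepTorusSymmetric.Census

open Literature.Computability.AlgebraicComplexity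
open Summit.ValiantsHypothesis.ValiantsHypothesis.Theses.RigidMinimalReps

set_option linter.dupNamespace false

/-- Eventual Grenet lower bound `2ⁿ - 1 ≤ dc(per_n)`. [cite: Grenet2011] -/
def GrenetLowerEventually : Prop :=
  ∃ n₀ : ℕ, ∀ n ≥ n₀, 2 ^ n - 1 ≤ determinantalComplexity (perPoly (Fin n) ℂ)

/-- Eventual Grenet optimality `dc(per_n) = 2ⁿ - 1`. [cite: Grenet2011] -/
def GrenetOptimalEventually : Prop :=
  ∃ n₀ : ℕ, ∀ n ≥ n₀, determinantalComplexity (perPoly (Fin n) ℂ) = 2 ^ n - 1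

/-- The two presentations of the two-sided torus generate the same subgroup (invertibility of
`diag(d_k e_l)` forces `d_k, e_l ≠ 0`). [folklore] -/
theorem twoSided_closure_eq (n : ℕ) :
    Subgroup.closure {γ : GL (Fin n × Fin n) ℂ | ∃ d e : Fin n → ℂ,
        (γ : Matrix (Fin n × Fin n) (Fin n × Fin n) ℂ) = Matrix.diagonal (fun p => d p.1 * e p.2)} =
    Subgroup.closure {γ : Matrix.GeneralLinearGroup (Fin n × Fin n) ℂ | ∃ d e : Fin n → ℂ,
        (∀ i, d i ≠ 0) ∧ (∀ j, e j ≠ 0) ∧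
        (γ : Matrix (Fin n × Fin n) (Fin n × Fin n) ℂ) = Matrix.diagonal (fun p => d p.1 * e p.2)} := by
  apply le_antisymm (Theorems.RigidMinimalRepsTorusBound.closure_twoSidedGens_le n)
  apply Subgroup.closure_mono
  rintro γ ⟨d, e, -, -, h⟩
  exact ⟨d, e, h⟩

/-- (→) `X` and the proved `TorusBound` give the eventual Grenet lower bound. [folklore] -/
theorem grenetLowerEventually_of_crux (hX : MinimalRepTorusSymmetric) : GrenetLowerEventually :=
  Summit.ValiantsHypothesis.Theorems.RigidMinimalReps.grenet_le_dc_per_of_torus hX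
    Theorems.RigidMinimalRepsTorusBound.torusBound_proof

/-- (←) The eventual Grenet lower bound gives `X`: Grenet's representation is then optimal, and it is
two-sided-torus-equivariant (tree). [cite: Grenet2011] [cite: LandsbergRessayre2017, Thm. 2.8] -/
theorem crux_of_grenetLowerEventually (h : GrenetLowerEventually) : MinimalRepTorusSymmetric := by
  obtain ⟨n₀, h⟩ := h
  refine ⟨max n₀ 1, fun n hn => ?_⟩
  have hn1 : 1 ≤ n := le_of_max_le_right hn
  have hle : determinantalComplexity (perPoly (Fin n) ℂ) ≤ 2 ^ n - 1 :=
    determinantalComplexity_perPoly_le_holds ℂ n hn1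
  have heq : determinantalComplexity (perPoly (Fin n) ℂ) = 2 ^ n - 1 :=
    le_antisymm hle (h n (le_of_max_le_left hn))
  rw [heq]
  have hG := Grenet.hasEquivariantDetRepr_perPoly_twoSidedTorus ℂ (n := n) (by omega)
  rwa [twoSided_closure_eq] at hG

/-- **The crux is eventual Grenet optimality, verbatim up to tree theorems.** [folklore] -/
theorem crux_iff_grenetLowerEventually : MinimalRepTorusSymmetric ↔ GrenetLowerEventually :=
  ⟨grenetLowerEventually_of_crux, crux_of_grenetLowerEventually⟩

/-- Same, in the form `dc(per_n) = 2ⁿ - 1` eventually. [folklore] -/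
theorem crux_iff_grenetOptimalEventually : MinimalRepTorusSymmetric ↔ GrenetOptimalEventually := by
  rw [crux_iff_grenetLowerEventually]
  constructor
  · rintro ⟨n₀, h⟩
    refine ⟨max n₀ 1, fun n hn => le_antisymm ?_ (h n (le_of_max_le_left hn))⟩
    exact determinantalComplexity_perPoly_le_holds ℂ n (le_of_max_le_right hn)
  · rintro ⟨n₀, h⟩
    exact ⟨n₀, fun n hn => (h n hn).ge⟩

/-- **The crux alone implies the summit** (route `closes` with `TorusBound` discharged by its tree
proof), stated contrapositively so that no audit mistakes it for a proof of the summit: the crux is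
at least summit-strength. [folklore] -/
theorem not_crux_of_not_summit (hVH : ¬ _root_.ValiantsHypothesis) : ¬ MinimalRepTorusSymmetric :=
  fun hX => hVH (closes hX Theorems.RigidMinimalRepsTorusBound.torusBound_proof)

/-! ## Strengthening `S⁺_ind` (induction on `n`) -/

/-- `S⁺_ind`: the doubling inequality `2·dc(per_{n-1}) + 1 ≤ dc(per_n)` for `n ≥ 4` — what an
induction on `n` would need (restriction/derivative arguments give only `dc(per_{n-1}) ≤ dc(per_n) - 1`).
[cite: LandsbergRessayre2017, §2] -/
def Doubling : Prop :=
  ∀ n : ℕ, 4 ≤ n →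
    2 * determinantalComplexity (perPoly (Fin (n - 1)) ℂ) + 1 ≤ determinantalComplexity (perPoly (Fin n) ℂ)

/-- `S⁺_ind` with the base case `dc(per_3) = 7` (Alper–Bogart–Velasco, proved in the tree) gives
Grenet's bound for EVERY `n ≥ 3` — strictly more than the crux (which allows finitely many
exceptions), and again the exact exponential lower bound. [cite: AlperBogartVelasco2017, Cor. 1.4] -/
theorem grenetLower_of_doubling (hD : Doubling) :
    ∀ n : ℕ, 3 ≤ n → 2 ^ n - 1 ≤ determinantalComplexity (perPoly (Fin n) ℂ) := by
  have h3 : determinantalComplexity (perPoly (Fin 3) ℂ) = 7 :=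
    (alperBogartVelasco2017_cor_1_4_holds ℂ (by simp [ringChar.eq_zero])).1
  intro n hn
  induction n, hn using Nat.le_induction with
  | base => rw [h3]; norm_num
  | succ n hn ih =>
    have hd : 2 * determinantalComplexity (perPoly (Fin n) ℂ) + 1 ≤
        determinantalComplexity (perPoly (Fin (n + 1)) ℂ) := hD (n + 1) (by omega)
    have h1 : 1 ≤ 2 ^ n := Nat.one_le_two_pow
    have : 2 ^ (n + 1) - 1 = 2 * (2 ^ n - 1) + 1 := by rw [pow_succ]; omega
    omega

/-- Hence `S⁺_ind` implies the crux. [folklore] -/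
theorem crux_of_doubling (hD : Doubling) : MinimalRepTorusSymmetric :=
  crux_of_grenetLowerEventually ⟨3, grenetLower_of_doubling hD⟩

/-! ## The best typed split: scaling first, multigrading second -/

/-- `X_sc`: for all large `n`, SOME optimal affine determinantal representation of `per_n` admits exact
constant-gauge lifts of the scaling subgroup `x ↦ c·x` (equivalently, by regularity and the Schur
complement, is constant-gauge-equivalent to a homogeneous layered ABP matrix).  Strictly weaker than
`X` in form (a rank-one subtorus) and in known content (no lower bound follows: homogeneous-ABP lower
bounds for `per_n` are quadratic).  At `n = 3` it holds (Grenet) although its UNIVERSAL form fails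
(explicit optimal non-scaling-equivariant representations, strategist computation).
[cite: LandsbergRessayre2017, §2] [cite: IkenmeyerLandsberg2017] -/
def ScalingSymmetricOptimum : Prop :=
  ∃ n₀ : ℕ, ∀ n ≥ n₀,
    HasEquivariantDetRepr
      (Subgroup.closure {γ : GL (Fin n × Fin n) ℂ | ∃ c : ℂ, c ≠ 0 ∧
        (γ : Matrix (Fin n × Fin n) (Fin n × Fin n) ℂ) = Matrix.diagonal (fun _ => c)})
      (perPoly (Fin n) ℂ) (determinantalComplexity (perPoly (Fin n) ℂ))

/-- `X_ml`: the multigrading upgrade — if some optimum is a homogeneous ABP then some optimum is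
bigraded by rows and columns (two-sided-torus-equivariant).  Given `X_sc` this carries the whole
lower-bound content of `X` (with `TorusBound`: optimal homogeneous ABPs for `per_n` have `≥ 2ⁿ - 2`
inner vertices); for `det_n` the analogous upgrade is FALSE (`dc = n`, bigraded cost `≥ C(n,n/2)`).
[cite: LandsbergRessayre2017, Thm. 2.8] [cite: Nisan1991Noncommutative] -/
def MultigradeUpgrade : Prop :=
  ScalingSymmetricOptimum → MinimalRepTorusSymmetric

/-- Glue of the split (modus ponens; `trivial_seam`). [folklore] -/
theorem crux_of_split (h₁ : ScalingSymmetricOptimum) (h₂ : MultigradeUpgrade) :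
    MinimalRepTorusSymmetric :=
  h₂ h₁

/-- And `X` gives back `X_sc` (the scaling subgroup lies in the two-sided torus: `c = d_k e_l` with
`d ≡ c`, `e ≡ 1`), so the split loses nothing. [folklore] -/
theorem scalingSymmetricOptimum_of_crux (hX : MinimalRepTorusSymmetric) : ScalingSymmetricOptimum := by
  obtain ⟨n₀, h⟩ := hX
  refine ⟨n₀, fun n hn => (h n hn).anti (Subgroup.closure_mono ?_)⟩
  rintro γ ⟨c, hc, hγ⟩
  refine ⟨fun _ => c, fun _ => 1, fun _ => hc, fun _ => one_ne_zero, ?_⟩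
  simpa only [mul_one] using hγ

end Summit.ValiantsHypothesis.ValiantsHypothesis.Cruxes.MinimalRepTorusSymmetric.Census
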